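import Summits.BirchSwinnertonDyer.BirchSwinnertonDyer.Theorems.PrintX11aUpperNonSurjFiveThreeCores
import Summits.BirchSwinnertonDyer.BirchSwinnertonDyer.Theorems.PrintX11aUpperNonSurjFiveExcShallowSector
import Summits.BirchSwinnertonDyer.Rank1Residual.Additive.PlusSymbolIntegrality
import Literature.NumberTheory.EllipticCurves.PAdicLFunctionIntegralityOddMultProofs
import Literature.NumberTheory.EllipticCurves.CanonicalPAdicHeightIntegralityProofs
import Literature.NumberTheory.EllipticCurves.PAdicHeightsTateValuationProofs
import Literature.NumberTheory.EllipticCurves.PAdicHeightsProofs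
import Literature.NumberTheory.EllipticCurves.PAdicBSDSplitMultiplicativeProofs
import HarnessLib

/-!
# Line «gsdepth5» — crux `Theses.PrintX11a.UpperNonSurjFive` (item stmt-BirchSwinnertonDyer-20614), lens «decomp»

Seat bsd-idea-6 g12 (planner-bsd-idea-6-g12-0), 2026-08-29.  PUBLISHED ONLY (W-79): the line of record stays «gl1cartan5»
(rev 10 → 11, lead `cruxlead-stmt-BirchSwinnertonDyer-20614`); this file is NOT passed to `ledger skeleton check`.  BSD is not proved by
any of this; no summit statement is proved here; the crux does NOT close (five `sorry`s, all inside `stub_*`).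

## Idea (one lever: GREENBERG–STEVENS DEPTH — the valuation of the `𝓛`-invariant pays the Tamagawa depth AT `p`)

After the lead's landed EXCEPTIONAL-ZERO road (`Theorems/PrintX11aUpperNonSurjFiveExcShallowSector.lean`, p686445: EXC-SHALLOW «`p` split,
`ord_p ∏ c ≤ 1`, `Ш[p] = 0`» CLOSED modulo seven named facts) the census-populated OPEN core of U5 is C_exc♭ = «`p` split ∧ (`Ш[p] ≠ 0` ∨
`ord_p ∏ c ≥ 2`)» (`EXC-CENSUS-cruxlead-g6.md`: 2 pairs at `p = 5`, `118080ds1` and `346560lh1`, both of depth `1 + 1` on TWO split carriers).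
Its depth clause lies beyond every congruence road of the cell (lead: «needs the congruence mod 5²»; «llzero5»: one `p` per level lowering).
NEW LEVER: at a split multiplicative `p` the Greenberg–Stevens formula (tree fact `greenberg_stevens`, Kobayashi 2006 Cor. 4.2 at every odd `p`)
reads, in the tree's normalisation,  `[T¹]L_p(E,T) · log_p γ = 𝓛_p(E) · [0]⁺_f`,  `𝓛_p(E) = log_p q_E / ord_p q_E`,  `ord_p q_E = v_p(Δ_min) = c_p`.
Valuations:  `ord_p [0]⁺_f = v(a₁) + v(log_p γ) + v_p(c_p) − v(log_p q_E)`, where `v(log_p γ) ≥ 1` (tree theorem `norm_padicLog_le_inv`), `v(a₁) ≥ 0`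
is a THEOREM (MTT integrality at an odd multiplicative prime, tree `norm_coeff_le_max_of_isSplitMultPAdicLFunctionOf`, with `‖[0]⁺_f‖ ≤ 1` from
`Additive.norm_ratPlusSymbol_le_one_of_irreducible`), and `v(log_p q_E) = 1` is the GENERIC «non-Wieferich Tate period» condition «w = 1»
(Skinner–Zhang 2014 hyp. (b) in the tree currency `(padicLog p D.q).valuation = 1`; fails with density `≈ 1/p`; a per-pair INSTRUMENT via
`valuation_padicLog_eq`: `w = ord_p((q p^{-k})^{p−1} − 1)`).  HENCE (real theorem `depth_add_le_padicValRat_ratPlusSymbol_zero`):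
  «w = 1» and `‖a₁‖ ≤ p^{−m}` ⟹ `ord_p (L(E,1)/Ω_E) ≥ v_p(c_p) + m` — the analytic side pays the WHOLE `p`-depth of the carrier `p` ITSELF (all of
  `v_p(c_p)`, not one `p`), with NO level lowering, NO Euler system, NO `μ`; with `m = 0` unconditionally (integrality).
SECTOR EXC-GS-A (REAL proof modulo GS-odd + modularity + Mazur + GZK): «X11a, `¬ Surj`, `5 ≤ p`, `p` split, `Ш[p] = 0`, w = 1, `ord_p ∏ c ≤ v_p(c_p)`»
⟹ `MissingUpperBoundAt W p`.  Re-proves EXC-SHALLOW ∩ {w = 1} WITHOUT the displayed newform ∕ Vatsal ∕ Ihara, and closes every deep SINGLE-carrier pair.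
SECTOR EXC-GS-B (KEY stub `stub_twinCarrierFirstMoment`, research-S/M): a SECOND split prime `ℓ ≠ p` (in X11a automatically a carrier: `¬ Ram` gives
`p ∣ v_ℓ(Δ) = c_ℓ`) makes `a₁ = [T¹]L` DIVISIBLE BY `p`: with the level-lowered newform `g` of the lead's road (`D` = all multiplicative primes `≠ p`,
the LANDED fact `ribet1990_levelLowering_gamma0_newform_general_of_five_le` BY NAME), `F` := `g` re-stabilised at `p` (`U_p`-root `α_p ≡ 1`) and at the
primes of `D` (constants `c_r = β_r/r ≡ a_r(f)`), Greenberg–Vatsal gives `ν_f ≡ ν_G (mod 𝔪)` as measures on `ℤ_p^×`, and the FIRST-MOMENT CYCLE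
  `M₁(Φ − cΦ(r·)) = (1 − c)·M₁(Φ) + c·ℓog(r)·M₀(Φ)`,   `M₀` after the `p`-stabilisation `= α_p⁻¹(α_p − 1)·Φ(0)/Ω ≡ 0`,   `1 − c_ℓ ≡ 1 − a_ℓ(f) = 0`
(`ℓog = log_p/log_p γ`; `M₁(ν_f) = a₁` by `IsSplitMultPAdicLFunctionOf.tendsto_riemannSum_coeff`) gives `a₁ ≡ 0 (mod 𝔪)`, i.e. `‖a₁‖ ≤ p⁻¹`
(`a₁ ∈ ℚ_p`).  Then «w = 1» ⟹ `ord_p (L/Ω_E) ≥ v_p(c_p) + 1`, closing «`ord_p ∏ c ≤ v_p(c_p) + 1`, a second split prime» — BOTH census pairs of C_exc♭,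
modulo the instrument `w₅ = 1` for them.  The lead's VALUE cycle (`ExcCoreCycle`, moment 0, killed by `(1 − α_p⁻¹)`) becomes a FIRST-MOMENT cycle killed
by `(1 − c_ℓ)` at the twin; every print ingredient (`hCE`, `hGV`, `hI`, `hLL`, `ExcMultiStab`, `ExcPeriod`, `ExcIhara`) is the lead's, BY NAME.
BSD-consistency of the lever: BSD predicts `ord_p(L/Ω_E) = Σ_{ℓ split} v_p(c_ℓ) + ord_p #Ш`, i.e. `v(a₁) = (w − 1) + Σ_{ℓ ≠ p split} v_p(c_ℓ) + ord_p #Ш`: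
«`a₁` sees the Wieferich defect, the OTHER carriers and `Ш`»; A is the case `Σ_{ℓ ≠ p} = 0`, B the first non-trivial case.

## Registered shape (5 stubs; `sorry` only inside `stub_*`)

* `stub_printFacts : PrintFacts` — `NineFacts` (the record's glue, verbatim «llzero5»/«sqparity5») ∧ `GSOdd` (`∀ W p, p ≠ 2 → greenberg_stevens`,
  verbatim the GS conjunct of «finemu3» r6) ∧ `ExcRoadFacts` (the lead's `hCE ∧ hGV ∧ hI ∧ hLL`, all named tree facts), BY NAME.
* `stub_twinCarrierFirstMoment : TwinCarrierFirstMoment` — KEY (research-S/M): `‖[T¹]L_p(E,T)‖ ≤ p⁻¹` given the lead's display data with a split prime in `D`.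
* `stub_exponentCore : ExponentCoreResidual`, `stub_deepTamagawaCore : DeepTamagawaCoreResidual` — the record's rev-10 NON-split cores VERBATIM.
* `stub_excResidualGS : ExcResidualGS` — the honest remainder of C_exc♭: split `p` and («`Ш[p] ≠ 0`» ∨ (`ord_p ∏ c ≥ 2` ∧ («w ≠ 1» ∨ «`ord_p ∏ c ≥
  v_p(c_p) + 2`» ∨ the EMPTY clause «`ord_p ∏ c > v_p(c_p)`, no second split prime»))); implied by C_exc♭ fact-free (`excResidualGS_of_excFlatCore`).
* REAL proofs: `depth_add_le_padicValRat_ratPlusSymbol_zero` (THE LEVER), `norm_coeff_one_le_one` (integrality, m = 0), `le_padicValRat_LOne_div_of_ratPlusSymbol`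
  (period transfer, Mazur Cor. 4.1 + GV Rem. 3.4 BY NAME), `excGSSectorA_of`, `excGSSectorB_of` (from the landed LL fact + KEY, the lead's decomposition
  verbatim), `excZeroCore_of_sectors` (C_exc = S_exc ⊔ A ⊔ B ⊔ R_exc, fact-free), `excResidualGS_of_excFlatCore` ∕ `excFlatCore_of_excZeroCore` ∕
  `excFlatCore_of_sectors` ∕ `parts_of_upperNonSurjFive` (comparison with rev 10/11, no costume), `UpperNonSurjFive_of_hyps`, and the composition
  `UpperNonSurjFive_of_gsdepth : Theses.PrintX11a.UpperNonSurjFive` through the landed turnkey `Theorems.GL1Cartan.upperNonSurjFive_of_nineFacts_of_threeCores`.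

References: [Kobayashi2006DocMath] Cor. 4.2; [GreenbergStevens1993] Thm. (0.3) = 7.1; [MazurTateTeitelbaum1986Invent] §I.10–I.13, §II.1;
[SkinnerZhang2014] Thm. 1.1 hyp. (b) and Lemma 2.8.1 (arXiv:1407.1099 pp. 3, 7–8); [BhargavaSkinnerZhang2014] Lemma 18; [GreenbergVatsal2000] §3 (17)–(19),
Prop. 3.7, Rem. 3.4; [Vatsal1999] Thm. 1.13; [DarmonDiamondTaylor1995] Thm. 3.15, Prop. 2.12; [Ribet1990] Thm. 1.1; [Ribet1984ICM] Thm. 4.1;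
[ColemanEdixhoven1998] Thm. 2.1; [Mazur1978] Cor. 4.1; [SilvermanATAEC1994] Cor. IV.9.2 (d), Thm. V.5.3; [Serre1972] Prop. 15; [Miller2011LMS] Def. 1.1.
-/

set_option linter.dupNamespace false
set_option autoImplicit false

noncomputable section

open scoped Classical NumberField MatrixGroups ModularForm

open CongruenceSubgroup WeierstrassCurve
  Literature.NumberTheory.EllipticCurves
  Literature.NumberTheory.EllipticCurves.ModularForms
  Literature.NumberTheory.EllipticCurves.Rank1Residual
  Literature.NumberTheory.EllipticCurves.Rank1Residual.Typed
  Literature.NumberTheory.EllipticCurves.Wuthrich2014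
  Summit.BirchSwinnertonDyer.Rank1Residual
  Summit.BirchSwinnertonDyer.BirchSwinnertonDyer.Theses
  Summit.BirchSwinnertonDyer.BirchSwinnertonDyer.Theorems.GL1Cartan

namespace Summit.BirchSwinnertonDyer.BirchSwinnertonDyer.Cruxes.UpperNonSurjFive.GSDepth

/-! ## §1 Statements -/

/-- **«w = 1» — the Tate period is non-Wieferich: `ord_p log_p q_E = 1`** (Skinner–Zhang 2014 hypothesis (b) in the tree's currency
`(padicLog p D.q).valuation = 1`, for every Tate parameter datum; `log_p` the Iwasawa logarithm; equivalently `(q_E p^{−ord q_E})^{p−1} ≢ 1 (mod p²)`,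
tree `valuation_padicLog_eq`).  Generic (density `1 − 1/p` heuristically); a per-pair instrument. [cite: SkinnerZhang2014, Thm. 1.1 (b)]
[cite: BhargavaSkinnerZhang2014, Lemma 18 (proof, p. 9)] -/
def LogTatePeriodUnit (W : WeierstrassCurve ℚ) [W.IsElliptic] [W.IsGloballyMinimal] (p : ℕ) [Fact p.Prime] : Prop :=
  ∀ D : TateParameterData W p, (padicLog p D.q).valuation = 1

/-- **The `p`-depth AT `p`: `v_p(v_p(Δ_min))`** — at a split multiplicative `p` this is `v_p(c_p)` (`c_p = v_p(Δ_min)` for split `I_n`,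
Kodaira–Néron). [cite: SilvermanATAEC1994, Cor. IV.9.2 (d) and Table 4.1] -/
def pDepthAtP (W : WeierstrassCurve ℚ) [W.IsGloballyMinimal] (p : ℕ) : ℕ :=
  padicValNat p (padicValInt p W.minimalDiscriminantInt)

/-- **SECTOR EXC-GS-A (closed below modulo GS-odd + modularity + Mazur Cor. 4.1 + GZK): the single effective carrier `p`.**  U5 on «X11a, `¬ Surj`,
`5 ≤ p`, `p` split, w = 1, `ord_p ∏ c_ℓ ≤ v_p(c_p)`, `Ш(E)[p] = 0`».  [cite: Kobayashi2006DocMath, Cor. 4.2 (p. 575)] [cite: Miller2011LMS, Def. 1.1] -/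
def ExcGSSectorA : Prop :=
  ∀ (W : WeierstrassCurve ℚ) [W.IsElliptic] [W.IsGloballyMinimal] (p : ℕ) [Fact p.Prime],
    ClassX11a W p → ¬ Surj W p → 5 ≤ p → W.HasSplitMultiplicativeReductionAtPrime p →
    LogTatePeriodUnit W p → padicValNat p W.tamagawaProduct ≤ pDepthAtP W p →
    (∀ x : W.sha, (p : ℤ) • x = 0 → x = 0) → MissingUpperBoundAt W p

/-- **The displayed level-lowered newform** (VERBATIM the binder `hex` of the lead's
`Theorems.GL1Cartan.Exc.one_le_padicValRat_LOne_div_realPeriod_of_exists_levelLoweredNewform`): for every field isomorphism `ι : ℚ̄_p ≃ ℂ` a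
newform `g ∈ S₂(Γ₀(M₀))` with `a_r(g) ≡ a_r(f)` at the primes `r ∤ D·p` and `a_r(g) ≡ a_r(f)(r + 1)` at `r ∣ D·p`, modulo the maximal ideal
after transport by `ι⁻¹`.  On class X11a at a non-surjective `p ≥ 5` it EXISTS with `D` = the product of ALL multiplicative primes `≠ p`
(all unramified: `¬ Ram`; `p` finite: `ClassX11a.dvd_padicValInt_self_of_not_surj`) by the LANDED named fact
`ribet1990_levelLowering_gamma0_newform_general_of_five_le` (Darmon–Diamond–Taylor Thm. 3.15, p685873; taken BY NAME below, exactly as in the lead's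
`Exc.one_le_padicValRat_LOne_div_of_classX11a_split`). [cite: DarmonDiamondTaylor1995, Thm. 3.15 (pp. 90–91)] [cite: Ribet1990, Thm. 1.1] -/
def LoweredDisplay (p : ℕ) [Fact p.Prime] {N : ℕ} (f : CuspForm (Gamma0 N) 2) (M₀ D : ℕ) [NeZero M₀] : Prop :=
  ∀ ι : PadicAlgCl p ≃+* ℂ, ∃ g : CuspForm (Gamma0 M₀) 2, IsNewform0 g ∧
    (∀ r : ℕ, r.Prime → ¬ r ∣ D * p → Valued.v (ι.symm (cuspCoeff f r - cuspCoeff g r)) < 1) ∧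
    (∀ r : ℕ, r.Prime → r ∣ D * p → Valued.v (ι.symm (cuspCoeff g r - cuspCoeff f r * (r + 1))) < 1)

/-- **B — THE KEY: the twin-carrier first moment (research-S/M).**  For minimal `E/ℚ`, `p ≥ 5` split multiplicative, `E[p]` irreducible,
`f = f_E` of level `N = N_E = M₀·D·p` with the lead's display data (`D` squarefree, prime to `M₀` and `p`, `a_r(f) = ±1` on `D`) and AT LEAST ONE
SPLIT prime in `D` (`a_r(f) = +1`), and the displayed level-lowered newform `g`: the first Taylor coefficient of THE split multiplicative `p`-adic
`L`-function (MTT, normalised by `Ω⁺_f`; `[T⁰] = 0` is the exceptional zero) satisfies `‖[T¹] L‖_p ≤ p⁻¹`.  PLAN (the lead's EXC road with the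
value cycle replaced by a first-moment cycle at `ℓ ∈ D` split): GV (`greenbergVatsal2000_plusSymbol_congruence`, pair `(f, G)` at level `N`,
Condition 1 for the oldform `G` by Coleman–Edixhoven) ⟹ `ν_f^{can} ≡ ν_G (mod 𝔪)` on `ℤ_p^×`; `Ω_f^{can}/Ω⁺_f` a unit (GV unit value +
`Additive.norm_ratPlusSymbol_le_one_of_irreducible`); `a₁ = M₁(ν_f) = ∫ ℓog dν_f` (`IsSplitMultPAdicLFunctionOf.tendsto_riemannSum_coeff`);
`G = F − c F(ℓ·)`, `c = α_ℓ⁻¹ ≡ 1`, `M₁(ν_G) = (1 − c) M₁(ν_F) + c ℓog(ℓ) M₀(ν_F)`, `M₀(ν_F) = α_p⁻¹(α_p − 1)Φ(0)/Ω ≡ 0`; `Φ/Ω` integral with a unit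
value through the stabilisations (`ExcPeriod`, `ExcMultiStab`, Ihara `ribet1984_iharaLemma` at `ℓ` AND at `p` as in `ExcIhara`).  Why it might
fail: the Ihara ∕ canonical-period comparison for `G` when `α_ℓ ≡ β_ℓ` (`ℓ ≡ 1 (mod p)`, e.g. `ℓ = 41`, `p = 5` for `118080ds1`) needs the
non-Eisenstein localisation exactly as in the lead's `ExcIhara`; a hidden unit from `Ω_G` vs `Ω` would not matter (only `≡ 0` is transported).
PRICES PAID (critic V#135): (P2) the stabilised form `G` is built from the LOWERED newform `g` (binder `hex : LoweredDisplay p f M₀ D`), not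
from `f`; `a₁ = (L).coeff 1 ∈ ℚ_p` (indeed `ℤ_p`) is the first Taylor coefficient of THE split `p`-adic `L`-function `L` of the binder `hL`.
(P1) BSD-CONSISTENCY holds ONLY because `LoweredDisplay` forces every `r ∣ D` to be a carrier (`ρ̄` unramified at `r` ⇔ `p ∣ c_r` at split `r`):
BSD predicts `ord_p a₁ = (w−1) + Σ_{ℓ≠p split} v_p(c_ℓ) + ord_p #Ш`, so a split `r` with `p ∤ c_r` (`r ∉ D`) would buy nothing — the twin is `r ∣ D`.
[cite: GreenbergVatsal2000, §3 (17)–(19) and Prop. 3.7] [cite: Vatsal1999, Thm. 1.13] [cite: MazurTateTeitelbaum1986Invent, §I.10–I.13]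
[cite: Ribet1984ICM, Thm. 4.1] [cite: ColemanEdixhoven1998, Thm. 2.1] -/
def TwinCarrierFirstMoment : Prop :=
  ∀ (W : WeierstrassCurve ℚ) [W.IsElliptic] [W.IsGloballyMinimal] (p : ℕ) [Fact p.Prime],
    5 ≤ p → W.HasSplitMultiplicativeReductionAtPrime p → W.HasIrreducibleModPGaloisRep p →
    ∀ {N : ℕ} [NeZero N], N = W.conductorNorm ℤ → ∀ {f : CuspForm (Gamma0 N) 2}, IsNewformOf W f →
    ∀ {M₀ D : ℕ} [NeZero M₀], M₀ * D * p = N → ¬ p ∣ M₀ * D → Squarefree D → Nat.Coprime D M₀ →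
    (∀ r : ℕ, r.Prime → r ∣ D → ∃ u : ℤ, u * u = 1 ∧ cuspCoeff f r = u) →
    (∃ r : ℕ, r.Prime ∧ r ∣ D ∧ cuspCoeff f r = 1) →
    LoweredDisplay p f M₀ D →
    ∀ {L : PowerSeries ℚ_[p]}, IsSplitMultPAdicLFunctionOf f p L → ‖PowerSeries.coeff 1 L‖ ≤ ((p : ℝ) ^ 1)⁻¹

/-- **SECTOR EXC-GS-B (closed below modulo GS-odd + LL + B + three of the nine facts): one unit of depth outside `p`.**  U5 on «X11a, `¬ Surj`,
`5 ≤ p`, `p` split, w = 1, `ord_p ∏ c_ℓ ≤ v_p(c_p) + 1`, a second split multiplicative prime exists, `Ш(E)[p] = 0`».  Census at `p = 5`: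
`118080ds1`, `346560lh1` (modulo `w_5 = 1`). [cite: Kobayashi2006DocMath, Cor. 4.2 (p. 575)] [cite: Miller2011LMS, Def. 1.1] -/
def ExcGSSectorB : Prop :=
  ∀ (W : WeierstrassCurve ℚ) [W.IsElliptic] [W.IsGloballyMinimal] (p : ℕ) [Fact p.Prime],
    ClassX11a W p → ¬ Surj W p → 5 ≤ p → W.HasSplitMultiplicativeReductionAtPrime p →
    LogTatePeriodUnit W p → padicValNat p W.tamagawaProduct ≤ pDepthAtP W p + 1 →
    (∃ ℓ : ℕ, ∃ _ : Fact ℓ.Prime, ℓ ≠ p ∧ W.HasSplitMultiplicativeReductionAtPrime ℓ) →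
    (∀ x : W.sha, (p : ℤ) • x = 0 → x = 0) → MissingUpperBoundAt W p

/-- **C_exp — the record's rev-10 EXPONENT core, VERBATIM** (`GL1Cartan.ExponentCoreResidual` of «gl1cartan5»; non-split `p`, `Ш[p] ≠ 0`,
hard value). [cite: Kato2004Asterisque, §17.13] -/
def ExponentCoreResidual : Prop :=
  ∀ (W : WeierstrassCurve ℚ) [W.IsElliptic] [W.IsGloballyMinimal] (p : ℕ) [Fact p.Prime],
    ClassX11a W p → ¬ Surj W p → 5 ≤ p → ¬ W.HasSplitMultiplicativeReductionAtPrime p →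
    (∃ x : W.sha, (p : ℤ) • x = 0 ∧ x ≠ 0) →
    (∀ t : ℚ, W.entireLFunction 1 / (W.realPeriodRat : ℂ) = (t : ℂ) → padicValRat p t ≠ 0) →
    MissingUpperBoundAt W p

/-- **C_tam — the record's rev-10 DEEP-TAMAGAWA core, VERBATIM** (`GL1Cartan.DeepTamagawaCoreResidual` of «gl1cartan5»; non-split `p`,
`ord_p ∏ c ≥ 2`, `Ш[p] = 0`, hard value; census-empty). [cite: Kato2004Asterisque, §17.13] -/
def DeepTamagawaCoreResidual : Prop :=
  ∀ (W : WeierstrassCurve ℚ) [W.IsElliptic] [W.IsGloballyMinimal] (p : ℕ) [Fact p.Prime],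
    ClassX11a W p → ¬ Surj W p → 5 ≤ p → ¬ W.HasSplitMultiplicativeReductionAtPrime p →
    2 ≤ padicValNat p W.tamagawaProduct → (∀ x : W.sha, (p : ℤ) • x = 0 → x = 0) →
    (∀ t : ℚ, W.entireLFunction 1 / (W.realPeriodRat : ℂ) = (t : ℂ) → padicValRat p t ≠ 0) →
    MissingUpperBoundAt W p

/-- **S_exc — the lead's EXC-SHALLOW sector, class-wide shape (CLOSED modulo seven named facts by the landed
`Theorems.GL1Cartan.Exc.upperNonSurjFive_on_excShallowSector_of_facts`, p686445; taken BY NAME below).**  U5 on «X11a, `¬ Surj`, `5 ≤ p`, `p` split,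
`ord_p ∏ c ≤ 1`, `Ш(E)[p] = 0`». [cite: DarmonDiamondTaylor1995, Thm. 3.15] [cite: GreenbergVatsal2000, §3 (17)–(19)] [cite: Miller2011LMS, Def. 1.1] -/
def ExcShallowSector : Prop :=
  ∀ (W : WeierstrassCurve ℚ) [W.IsElliptic] [W.IsGloballyMinimal] (p : ℕ) [Fact p.Prime],
    ClassX11a W p → ¬ Surj W p → 5 ≤ p → W.HasSplitMultiplicativeReductionAtPrime p →
    padicValNat p W.tamagawaProduct ≤ 1 → (∀ x : W.sha, (p : ℤ) • x = 0 → x = 0) → MissingUpperBoundAt W p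

/-- **C_exc♭ — the lead's rev-11 open EXCEPTIONAL core** (`EXC-CENSUS-cruxlead-g6.md`: «`p` split ∧ (`Ш(E)[p] ≠ 0` ∨ `ord_p ∏c ≥ 2`)»; U5 verbatim,
restricted; this line's transcription of the census wording — the rev-11 skeleton decl may differ in form).  Census at `p = 5`, `N < 5·10⁵`: 2 pairs
(`118080ds1`, `346560lh1`, both `ord₅ ∏ c = 2` with TWO split carriers) + 0 with `Ш[5] ≠ 0`. [cite: Kato2004Asterisque, §17.13] [cite: Miller2011LMS, Def. 1.1] -/
def ExcFlatCore : Prop :=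
  ∀ (W : WeierstrassCurve ℚ) [W.IsElliptic] [W.IsGloballyMinimal] (p : ℕ) [Fact p.Prime],
    ClassX11a W p → ¬ Surj W p → 5 ≤ p → W.HasSplitMultiplicativeReductionAtPrime p →
    ((∃ x : W.sha, (p : ℤ) • x = 0 ∧ x ≠ 0) ∨ 2 ≤ padicValNat p W.tamagawaProduct) → MissingUpperBoundAt W p

/-- **R_exc — the residual of C_exc♭ after the two GS sectors (U5 verbatim, restricted; implied by C_exc♭ fact-free, `excResidualGS_of_excFlatCore`:
the line asks NO MORE of the future than rev 11).**  Split `p` and: «`Ш(E)[p] ≠ 0`» (the common Euler-system wall, `EulerSystemBigImageAtSmallImage`;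
0 census pairs), or «`ord_p ∏ c ≥ 2`» TOGETHER WITH one of «w ≠ 1» (Wieferich Tate period: the GS lever is blind), «`ord_p ∏ c ≥ v_p(c_p) + 2`» (two
units of depth outside `p`: no newform congruence modulo `p²`; census-empty), or the clause «`ord_p ∏ c > v_p(c_p)`, no second split prime», which is
EMPTY (`ord_p ∏ c = Σ_{ℓ split} v_p(c_ℓ)` for `p ≥ 5`, Kodaira–Néron; XS plumbing via `X11b.dvd_tamagawaProduct_iff_exists_split`-type census, left
open here).  Census at `p = 5`: R_exc = {`118080ds1`, `346560lh1`} ∩ {w₅ ≠ 1} — conjecturally EMPTY given the instrument.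
[cite: Kato2004Asterisque, §17.13] [cite: SilvermanATAEC1994, Cor. IV.9.2 (d) and Table 4.1] [cite: SkinnerZhang2014, Thm. 1.1 (b)] -/
def ExcResidualGS : Prop :=
  ∀ (W : WeierstrassCurve ℚ) [W.IsElliptic] [W.IsGloballyMinimal] (p : ℕ) [Fact p.Prime],
    ClassX11a W p → ¬ Surj W p → 5 ≤ p → W.HasSplitMultiplicativeReductionAtPrime p →
    ((∃ x : W.sha, (p : ℤ) • x = 0 ∧ x ≠ 0) ∨
      (2 ≤ padicValNat p W.tamagawaProduct ∧
        (¬ LogTatePeriodUnit W p ∨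
          pDepthAtP W p + 2 ≤ padicValNat p W.tamagawaProduct ∨
          (pDepthAtP W p < padicValNat p W.tamagawaProduct ∧
            ¬ ∃ ℓ : ℕ, ∃ _ : Fact ℓ.Prime, ℓ ≠ p ∧ W.HasSplitMultiplicativeReductionAtPrime ℓ)))) →
    MissingUpperBoundAt W p

/-- **The nine print-exact named facts of the record's glue (one conjunction, BY NAME; verbatim «llzero5»/«sqparity5»'s `NineFacts`).**
[cite: SteinWuthrich2013, Thm. 6.1] [cite: Kato2004Asterisque, Thm. 12.4 and §17.13] [cite: Mazur1978, Cor. 4.1] [cite: Kolyvagin1990, Thm.] -/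
def NineFacts : Prop :=
  Literature.NumberTheory.EllipticCurves.SteinWuthrich2013.thm61_splitMultiplicative ∧
    Literature.NumberTheory.EllipticCurves.SteinWuthrich2013.thm61_nonsplitMultiplicative ∧
    Literature.NumberTheory.EllipticCurves.Kato2004.thm12_4 ∧
    Literature.NumberTheory.EllipticCurves.ModularForms.exists_isNewformOf ∧
    Literature.NumberTheory.EllipticCurves.Kato2004.exists_multDivisibilityInputs_nonsplit_contra ∧
    Literature.NumberTheory.EllipticCurves.Kato2004.exists_multDivisibilityInputs_split_contra ∧
    Literature.NumberTheory.EllipticCurves.Kato2004.exists_multDivisibilityInputs_fine_contra ∧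
    Literature.NumberTheory.EllipticCurves.ModularForms.mazur_not_dvd_maninConstant_of_odd ∧
    rank_eq_analyticRank_of_analyticRank_le_one

/-- **GS at ODD primes, BY NAME** (verbatim the GS conjunct of «finemu3» r6 ∕ `Theorems/PrintX11aUpperNonSurjFiveOfNineFactsOddGS`: Kobayashi 2006
Cor. 4.2 as printed, no `p = 2` instance). [cite: Kobayashi2006DocMath, Cor. 4.2 (p. 575)] -/
def GSOdd : Prop :=
  ∀ (W : WeierstrassCurve ℚ) [W.IsElliptic] [W.IsGloballyMinimal] (p : ℕ) [Fact p.Prime],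
    p ≠ 2 → greenberg_stevens (W := W) (p := p)

/-- **The four named facts of the lead's EXCEPTIONAL-ZERO road, BY NAME** (Coleman–Edixhoven 1998 Thm. 2.1, Greenberg–Vatsal 2000 §3 (17)–(19),
Ihara's lemma = Ribet 1984 Thm. 4.1, and the landed level-lowering fact at `p ≥ 5` = Darmon–Diamond–Taylor Thm. 3.15). [cite: ColemanEdixhoven1998, Thm. 2.1]
[cite: GreenbergVatsal2000, §3 (17)–(19)] [cite: Ribet1984ICM, Thm. 4.1] [cite: DarmonDiamondTaylor1995, Thm. 3.15 (pp. 90–91)] -/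
def ExcRoadFacts : Prop :=
  colemanEdixhoven1998_heckePolynomial_simpleRoots ∧ greenbergVatsal2000_plusSymbol_congruence ∧ ribet1984_iharaLemma ∧
    ribet1990_levelLowering_gamma0_newform_general_of_five_le

/-- **The print inputs of this line: the nine facts ∧ GS-odd ∧ the four EXC-road facts (fourteen named facts, one conjunction).**
[cite: Kobayashi2006DocMath, Cor. 4.2 (p. 575)] [cite: Kato2004Asterisque, Thm. 12.4] [cite: DarmonDiamondTaylor1995, Thm. 3.15] -/
def PrintFacts : Prop := NineFacts ∧ GSOdd ∧ ExcRoadFacts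

/-! ## §2 Stubs (5; `sorry` only here) -/

/-- stub PRINT (fourteen named facts BY NAME: the nine facts, GS at odd primes, the four EXC-road facts). [cite: SteinWuthrich2013, Thm. 6.1]
[cite: Kobayashi2006DocMath, Cor. 4.2] [cite: DarmonDiamondTaylor1995, Thm. 3.15] -/
theorem stub_printFacts : PrintFacts := by
  sorry

/-- stub B (KEY; research-S/M): the twin-carrier first moment `‖[T¹]L_p(E,T)‖ ≤ p⁻¹`. [cite: GreenbergVatsal2000, §3 (17)–(19)]
[cite: MazurTateTeitelbaum1986Invent, §I.10–I.13] [cite: Ribet1984ICM, Thm. 4.1] -/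
theorem stub_twinCarrierFirstMoment : TwinCarrierFirstMoment := by
  sorry

/-- stub C_exp (residual; the record's rev-10 core verbatim). [cite: Kato2004Asterisque, §17.13] -/
theorem stub_exponentCore : ExponentCoreResidual := by
  sorry

/-- stub C_tam (residual; the record's rev-10 core verbatim). [cite: Kato2004Asterisque, §17.13] -/
theorem stub_deepTamagawaCore : DeepTamagawaCoreResidual := by
  sorry

/-- stub R_exc (residual; U5 verbatim on the complement of the two GS sectors inside C_exc♭). [cite: Kato2004Asterisque, §17.13] -/
theorem stub_excResidualGS : ExcResidualGS := by
  sorry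

/-! ## §3 Real proofs -/

section Lever

variable {W : WeierstrassCurve ℚ} [W.IsElliptic] [W.IsGloballyMinimal] {p : ℕ} [Fact p.Prime]

/-- **THE LEVER — Greenberg–Stevens depth (real proof).**  At a split multiplicative `p ≠ 2` with Tate datum `D`, «w = 1» and
`‖[T¹]L‖ ≤ p^{−m}` for THE split `p`-adic `L`-function: `m + v_p(v_p Δ_min) ≤ ord_p [0]⁺_f` (when `[0]⁺_f ≠ 0`).  Valuations in
`a₁ · log_p γ = (log_p q / ord_p q) · [0]⁺_f` with `v(log_p γ) ≥ 1` (`norm_padicLog_le_inv`), `ord_p q = v_p(Δ_min)`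
(`TateParameterData.valuation_q_eq_padicValInt_holds`). [cite: Kobayashi2006DocMath, Cor. 4.2 (p. 575)] [cite: MazurTateTeitelbaum1986Invent, §II.1]
[cite: BhargavaSkinnerZhang2014, Lemma 18 (proof, p. 9)] -/
theorem depth_add_le_padicValRat_ratPlusSymbol_zero (hp2 : p ≠ 2)
    (hGS : greenberg_stevens (W := W) (p := p)) (D : TateParameterData W p)
    (hw : (padicLog p D.q).valuation = 1)
    {N : ℕ} [NeZero N] {f : CuspForm (Gamma0 N) 2} (hf : IsNewformOf W f)
    {L : PowerSeries ℚ_[p]} (hL : IsSplitMultPAdicLFunctionOf f p L)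
    {m : ℕ} (ha : ‖PowerSeries.coeff 1 L‖ ≤ ((p : ℝ) ^ m)⁻¹) (h0 : ratPlusSymbol f 0 ≠ 0) :
    ((m + pDepthAtP W p : ℕ) : ℤ) ≤ padicValRat p (ratPlusSymbol f 0) := by
  have hp : p.Prime := Fact.out
  have h1p : (1 : ℝ) < p := by exact_mod_cast hp.one_lt
  obtain ⟨-, hid⟩ := hGS D hf hL
  set a : ℚ_[p] := PowerSeries.coeff 1 L with ha_def
  set lg : ℚ_[p] := padicLog p (cyclotomicGenerator p) with hlg_def
  set b : ℚ_[p] := ((ratPlusSymbol f 0 : ℚ) : ℚ_[p]) with hb_def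
  set k : ℕ := padicValInt p W.minimalDiscriminantInt with hk_def
  have hk : D.q.valuation = (k : ℤ) :=
    TateParameterData.valuation_q_eq_padicValInt_holds (W := W) (p := p) D
  have hk0 : k ≠ 0 := by
    intro h0
    have hpos := D.valuation_q_pos
    rw [hk, h0] at hpos
    norm_num at hpos
  have hkq : (D.q.valuation : ℚ_[p]) = ((k : ℕ) : ℚ_[p]) := by
    rw [hk, Int.cast_natCast]
  have hkne : ((k : ℕ) : ℚ_[p]) ≠ 0 := by exact_mod_cast hk0
  have hlogq0 : padicLog p D.q ≠ 0 := by
    intro h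
    rw [h, Padic.valuation_zero] at hw
    exact zero_ne_one hw
  have hLinv : LInvariant D = padicLog p D.q / ((k : ℕ) : ℚ_[p]) := by
    unfold LInvariant
    rw [hkq]
  have hLinv0 : LInvariant D ≠ 0 := by
    rw [hLinv]
    exact div_ne_zero hlogq0 hkne
  have hb0 : b ≠ 0 := by
    rw [hb_def]
    exact_mod_cast h0
  have hrhs0 : LInvariant D * b ≠ 0 := mul_ne_zero hLinv0 hb0
  have hid' : a * lg = LInvariant D * b := hid
  have ha0 : a ≠ 0 := by
    intro h
    rw [h, zero_mul] at hid'
    exact hrhs0 hid'.symm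
  have hlg0 : lg ≠ 0 := by
    intro h
    rw [h, mul_zero] at hid'
    exact hrhs0 hid'.symm
  -- valuations of the two sides
  have hv := congrArg Padic.valuation hid'
  rw [Padic.valuation_mul ha0 hlg0, Padic.valuation_mul hLinv0 hb0, hLinv, div_eq_mul_inv,
    Padic.valuation_mul hlogq0 (inv_ne_zero hkne), Padic.valuation_inv, hw, Padic.valuation_natCast] at hv
  -- `v(a) ≥ m` from the norm bound
  have hva : (m : ℤ) ≤ a.valuation := by
    have h := ha
    rw [Padic.norm_eq_zpow_neg_valuation ha0, ← zpow_natCast, ← zpow_neg,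
      zpow_le_zpow_iff_right₀ h1p] at h
    omega
  -- `v(log_p γ) ≥ 1`
  have hvlg : (1 : ℤ) ≤ lg.valuation := by
    have h := norm_padicLog_le_inv hp2 (cyclotomicGenerator p : ℚ_[p])
    rw [← hlg_def, Padic.norm_eq_zpow_neg_valuation hlg0, ← zpow_neg_one,
      zpow_le_zpow_iff_right₀ h1p] at h
    omega
  have hvb : b.valuation = padicValRat p (ratPlusSymbol f 0) := by
    rw [hb_def, Padic.valuation_ratCast]
  rw [← hvb]
  unfold pDepthAtP
  rw [← hk_def, Nat.cast_add]
  omega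

/-- **Integrality of `[T¹]L` (a THEOREM, not a stub): `‖[T¹]L_p(E,T)‖ ≤ 1` at an odd split multiplicative `p` with `E[p]` irreducible**
(`‖[T^k]L‖ ≤ max(1, ‖[0]⁺_f‖)` — MTT §I.10–I.13, tree `norm_coeff_le_max_of_isSplitMultPAdicLFunctionOf` — and `‖[0]⁺_f‖ ≤ 1`,
`Additive.norm_ratPlusSymbol_le_one_of_irreducible`). [cite: MazurTateTeitelbaum1986Invent, §I.10 and §I.12–I.13] [cite: GreenbergVatsal2000, Prop. 3.7] -/
theorem norm_coeff_one_le_one (hp2 : p ≠ 2) (hsplit : W.HasSplitMultiplicativeReductionAtPrime p)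
    (hirr : W.HasIrreducibleModPGaloisRep p)
    {N : ℕ} [NeZero N] {f : CuspForm (Gamma0 N) 2} (hf : IsNewformOf W f)
    {L : PowerSeries ℚ_[p]} (hL : IsSplitMultPAdicLFunctionOf f p L) :
    ‖PowerSeries.coeff 1 L‖ ≤ ((p : ℝ) ^ 0)⁻¹ := by
  rw [pow_zero, inv_one]
  refine (norm_coeff_le_max_of_isSplitMultPAdicLFunctionOf hf hp2 hsplit hL 1).trans (max_le le_rfl ?_)
  exact Additive.norm_ratPlusSymbol_le_one_of_irreducible hp2 hf hirr 0

/-- **Period transfer (real proof; Mazur Cor. 4.1 + Greenberg–Vatsal Rem. 3.4 BY NAME, as in the lead's §2):** a lower bound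
`m ≤ ord_p [0]⁺_f` becomes `m ≤ ord_p (L(E,1)/Ω_E)` (`Ω_E = u·Ω⁺_f`, `|u|_p = 1`, tree theorem
`SkinnerUrban2014.realPeriodRat_eq_unit_mul_plusPeriod_of_multiplicative_of_mazur`; `L(E,1) = [0]⁺_f·Ω⁺_f`). [cite: Mazur1978, Cor. 4.1]
[cite: GreenbergVatsal2000, §3, Remark 3.4] [cite: MazurTateTeitelbaum1986Invent, §I.8] -/
theorem le_padicValRat_LOne_div_of_ratPlusSymbol (hMz : mazur_not_dvd_maninConstant_of_odd)
    (W : WeierstrassCurve ℚ) [W.IsElliptic] [W.IsGloballyMinimal] {p : ℕ} [Fact p.Prime] (hp5 : 5 ≤ p)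
    (hmult : W.HasMultiplicativeReductionAtPrime p) (hirr : W.HasIrreducibleModPGaloisRep p)
    {N : ℕ} [NeZero N] {f : CuspForm (Gamma0 N) 2} (hf : IsNewformOf W f) (m : ℤ)
    (hb : ratPlusSymbol f 0 ≠ 0 → m ≤ padicValRat p (ratPlusSymbol f 0)) :
    ∀ t : ℚ, W.entireLFunction 1 / (W.realPeriodRat : ℂ) = (t : ℂ) → t ≠ 0 → m ≤ padicValRat p t := by
  intro t ht ht0
  obtain ⟨u, hu, hΩ⟩ :=
    SkinnerUrban2014.realPeriodRat_eq_unit_mul_plusPeriod_of_multiplicative_of_mazur hMz W p hp5 hmult hirr f hf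
  have hΩpos : 0 < W.realPeriodRat := W.realPeriodRat_pos_holds
  have hΩC : (W.realPeriodRat : ℂ) ≠ 0 := Complex.ofReal_ne_zero.mpr hΩpos.ne'
  have hu0 : u ≠ 0 := by
    rintro rfl
    rw [Rat.cast_zero, zero_mul] at hΩ
    exact hΩpos.ne' hΩ
  have hLval : W.entireLFunction 1 = ((((ratPlusSymbol f 0 : ℚ) : ℝ) * plusPeriod f : ℝ) : ℂ) :=
    hf.entireLFunction_one_eq
  have hplus : plusPeriod f = W.realPeriodRat / u := by
    rw [hΩ, mul_div_cancel_left₀ _ (Rat.cast_ne_zero.mpr hu0)]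
  have ht' : W.entireLFunction 1 / (W.realPeriodRat : ℂ) = ((ratPlusSymbol f 0 / u : ℚ) : ℂ) := by
    rw [hLval, hplus, div_eq_iff hΩC]
    push_cast
    have huC : ((u : ℝ) : ℂ) ≠ 0 := by exact_mod_cast hu0
    field_simp
  have hteq : t = ratPlusSymbol f 0 / u := by
    have h : ((t : ℚ) : ℂ) = ((ratPlusSymbol f 0 / u : ℚ) : ℂ) := by rw [← ht, ht']
    exact_mod_cast h
  have hb0 : ratPlusSymbol f 0 ≠ 0 := by
    intro h0
    apply ht0
    rw [hteq, h0, zero_div]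
  rw [hteq, padicValRat.div hb0 hu0, Rank1Residual.padicValRat_eq_zero_of_norm_ratCast_eq_one hu, sub_zero]
  exact hb hb0

end Lever

/-- **SECTOR EXC-GS-A, class-wide (real proof; CONDITIONAL on GS-odd + modularity + Mazur Cor. 4.1 + GZK).**  `ord_p #Ш_an = ord_p (L/Ω_E) − ord_p ∏ c`
(`padicValRat_shaAn_eq_sub_tamagawa`) `≥ v_p(c_p) − ord_p ∏ c ≥ 0` by THE LEVER with `m = 0` (integrality theorem) and «w = 1»; the door
`ClassX11a.missingUpperBoundAt_of_noPTorsion` concludes. [cite: Kobayashi2006DocMath, Cor. 4.2 (p. 575)] [cite: SilvermanATAEC1994, Cor. IV.9.2 (d)]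
[cite: Miller2011LMS, Def. 1.1 (arXiv:1010.2431 p. 3)] -/
theorem excGSSectorA_of (hGS : GSOdd) (hnf : exists_isNewformOf) (hMz : mazur_not_dvd_maninConstant_of_odd)
    (hGZK : rank_eq_analyticRank_of_analyticRank_le_one) : ExcGSSectorA := by
  intro W _ _ p _ hX hns hp5 hsp hw hdepth hSha
  have hp2 : p ≠ 2 := hX.ne_two
  obtain ⟨t, ht, ht0, -⟩ := hX.exists_LOne_div_realPeriod_eq_of_mazur hnf hMz hp5
  have hL1 : W.entireLFunction 1 ≠ 0 := by
    intro h0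
    apply ht0
    have h : ((t : ℚ) : ℂ) = 0 := by rw [← ht, h0, zero_div]
    exact_mod_cast h
  obtain ⟨-, -, -, hsha⟩ := shaAn_eq_of_L_one_div_eq hGZK W hL1 ht
  have hvq := padicValRat_shaAn_eq_sub_tamagawa hGZK hnf hMz hX hp5 hsha ht
  refine hX.missingUpperBoundAt_of_noPTorsion hGZK hsha ?_ hSha
  rw [hvq]
  -- the lever, with `m = 0`
  haveI : NeZero (W.conductorNorm ℤ) := ⟨(W.conductorNorm_pos_holds).ne'⟩
  obtain ⟨f, hf⟩ := hnf W
  obtain ⟨D⟩ := (nonempty_tateParameterData_iff_holds (W := W) (p := p)).mpr hsp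
  obtain ⟨L, hL, -⟩ := existsUnique_isSplitMultPAdicLFunctionOf_holds hsp hf
  have hdep : ((pDepthAtP W p : ℕ) : ℤ) ≤ padicValRat p t := by
    refine le_padicValRat_LOne_div_of_ratPlusSymbol hMz W hp5 hX.mult hX.irr hf _ (fun hb0 => ?_) t ht ht0
    have h := depth_add_le_padicValRat_ratPlusSymbol_zero hp2 (hGS W p hp2) D (hw D) hf hL
      (norm_coeff_one_le_one hp2 hsp hX.irr hf hL) hb0
    simpa using h
  have hdepth' : (padicValNat p W.tamagawaProduct : ℤ) ≤ pDepthAtP W p := by exact_mod_cast hdepth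
  linarith

/-- **SECTOR EXC-GS-B, class-wide (real proof; CONDITIONAL on GS-odd + the landed level-lowering fact + the KEY B + modularity + Mazur + GZK).**
`N = M₀·D·p` with `D` = ALL multiplicative primes `≠ p` (`Exc.exists_multDecomposition`); on X11a every prime of `D` is unramified (`¬ Ram`) and `p` is
finite (`ClassX11a.dvd_padicValInt_self_of_not_surj`), so the landed fact displays the level-`M₀` newform (VERBATIM the lead's road); the second split
prime `ℓ` divides `D` with `a_ℓ(f) = +1`; B gives `‖[T¹]L‖ ≤ p⁻¹`; THE LEVER with `m = 1` gives `ord_p (L/Ω_E) ≥ v_p(c_p) + 1 ≥ ord_p ∏ c`, and the door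
concludes. [cite: Kobayashi2006DocMath, Cor. 4.2 (p. 575)] [cite: DarmonDiamondTaylor1995, Thm. 3.15 and Prop. 2.12] [cite: SilvermanATAEC1994, Cor. IV.9.2 (d)]
[cite: Miller2011LMS, Def. 1.1] -/
theorem excGSSectorB_of (hGS : GSOdd) (hLL : ribet1990_levelLowering_gamma0_newform_general_of_five_le) (hB : TwinCarrierFirstMoment)
    (hnf : exists_isNewformOf) (hMz : mazur_not_dvd_maninConstant_of_odd)
    (hGZK : rank_eq_analyticRank_of_analyticRank_le_one) : ExcGSSectorB := by
  intro W _ _ p _ hX hns hp5 hsp hw htam htwin hSha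
  obtain ⟨ℓ, hℓ, hℓp, hspℓ⟩ := htwin
  have hp : p.Prime := Fact.out
  have hp2 : p ≠ 2 := hX.ne_two
  obtain ⟨t, ht, ht0, -⟩ := hX.exists_LOne_div_realPeriod_eq_of_mazur hnf hMz hp5
  have hL1 : W.entireLFunction 1 ≠ 0 := by
    intro h0
    apply ht0
    have h : ((t : ℚ) : ℂ) = 0 := by rw [← ht, h0, zero_div]
    exact_mod_cast h
  obtain ⟨-, -, -, hsha⟩ := shaAn_eq_of_L_one_div_eq hGZK W hL1 ht
  have hvq := padicValRat_shaAn_eq_sub_tamagawa hGZK hnf hMz hX hp5 hsha ht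
  refine hX.missingUpperBoundAt_of_noPTorsion hGZK hsha ?_ hSha
  rw [hvq]
  -- the newform at level `N = N_E`, the Tate datum, THE split function
  haveI : NeZero (W.conductorNorm ℤ) := ⟨(W.conductorNorm_pos_holds).ne'⟩
  obtain ⟨f, hf⟩ := hnf W
  obtain ⟨τ⟩ := (nonempty_tateParameterData_iff_holds (W := W) (p := p)).mpr hsp
  obtain ⟨L, hL, -⟩ := existsUnique_isSplitMultPAdicLFunctionOf_holds hsp hf
  -- `N = M₀·D·p`, `D` = all multiplicative primes `≠ p` (VERBATIM the lead's `one_le_padicValRat_LOne_div_of_classX11a_split`)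
  have hmult : W.HasMultiplicativeReductionAtPrime p := hsp.hasMultiplicativeReductionAtPrime
  obtain ⟨M₀, D, hM₀0, hMD, hpMD, hDsq, hDM₀, hDprimes, hmultD⟩ := Exc.exists_multDecomposition W p hmult
  haveI : NeZero M₀ := ⟨hM₀0⟩
  have hpD : ¬ p ∣ D := fun h => hpMD (h.mul_left M₀)
  have hpM₀ : ¬ p ∣ M₀ := fun h => hpMD (h.mul_right D)
  have hMR : M₀ * (D * p) = W.conductorNorm ℤ := by rw [← mul_assoc]; exact hMD
  have hRsq : Squarefree (D * p) :=
    (Nat.squarefree_mul ((Nat.Prime.coprime_iff_not_dvd hp).mpr hpD).symm).mpr ⟨hDsq, hp.prime.squarefree⟩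
  have hRcop : Nat.Coprime (D * p) M₀ := Nat.Coprime.mul_left hDM₀ ((Nat.Prime.coprime_iff_not_dvd hp).mpr hpM₀)
  have hp2N : ¬ p ^ 2 ∣ W.conductorNorm ℤ :=
    Theorems.not_sq_dvd_conductorNorm_of_hasMultiplicativeReductionAtPrime W p hmult
  have hR : ∀ (r : ℕ) (hr : r.Prime), r ∣ D * p →
      (haveI : Fact r.Prime := ⟨hr⟩; W.HasMultiplicativeReductionAtPrime r) ∧ p ∣ padicValInt r W.minimalDiscriminantInt := by
    intro r hr hrDp
    by_cases hrp : r = p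
    · subst hrp
      exact ⟨hmult, hX.dvd_padicValInt_self_of_not_surj hns⟩
    · have hrD : r ∣ D := by
        rcases (Nat.Prime.dvd_mul hr).mp hrDp with h | h
        · exact h
        · exact absurd ((Nat.prime_dvd_prime_iff_eq hr hp).mp h) hrp
      obtain ⟨-, hmr⟩ := hDprimes r hr hrD
      haveI : Fact r.Prime := ⟨hr⟩
      refine ⟨hmr, ?_⟩
      by_contra hnd
      exact hX.2.2.2.2 ⟨r, ⟨hr⟩, hrp, hmr, hnd⟩
  have hK : ∀ (q : ℕ) (hq : q.Prime), (haveI : Fact q.Prime := ⟨hq⟩; W.HasMultiplicativeReductionAtPrime q) → ¬ q ∣ D * p →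
      ¬ p ∣ padicValInt q W.minimalDiscriminantInt := by
    intro q hq hqm hqR
    exfalso
    by_cases hqp : q = p
    · subst hqp; exact hqR (dvd_mul_left q D)
    · exact hqR ((hmultD q hq hqm hqp).mul_right p)
  have hex : LoweredDisplay p f M₀ D :=
    fun ι => hLL W p hp5 hX.irr hMR hRsq hRcop hp2N rfl hR hK f hf ι
  have hsign : ∀ r : ℕ, r.Prime → r ∣ D → ∃ u : ℤ, u * u = 1 ∧ cuspCoeff f r = u := by
    intro r hr hrD
    haveI : Fact r.Prime := ⟨hr⟩
    obtain ⟨-, hmr⟩ := hDprimes r hr hrD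
    refine ⟨W.LFunction r, ?_, hf.2 r⟩
    have hsq := (LFunction_prime_pow_of_hasMultiplicativeReductionAtPrime W r hmr 0).2
    rw [pow_two] at hsq
    exact hsq
  -- the twin: a SPLIT prime of `D`
  have hℓD : ℓ ∣ D := hmultD ℓ hℓ.out hspℓ.hasMultiplicativeReductionAtPrime hℓp
  have haℓ : cuspCoeff f ℓ = 1 := (hf.cuspCoeff_eq_one_and_sq_of_split hspℓ).1
  have ha : ‖PowerSeries.coeff 1 L‖ ≤ ((p : ℝ) ^ 1)⁻¹ :=
    hB W p hp5 hsp hX.irr rfl hf hMD hpMD hDsq hDM₀ hsign ⟨ℓ, hℓ.out, hℓD, haℓ⟩ hex hL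
  have hdep : ((1 + pDepthAtP W p : ℕ) : ℤ) ≤ padicValRat p t :=
    le_padicValRat_LOne_div_of_ratPlusSymbol hMz W hp5 hmult hX.irr hf _
      (fun hb0 => depth_add_le_padicValRat_ratPlusSymbol_zero hp2 (hGS W p hp2) τ (hw τ) hf hL ha hb0) t ht ht0
  have htam' : (padicValNat p W.tamagawaProduct : ℤ) ≤ pDepthAtP W p + 1 := by exact_mod_cast htam
  rw [Nat.cast_add, Nat.cast_one] at hdep
  linarith

/-- **C_exc from S_exc (the lead's EXC-SHALLOW), the two GS sectors and the residual (fact-free).**  Case split on «`Ш(E)[p] = 0`»,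
«`ord_p ∏ c ≤ 1`», «w = 1», «`ord_p ∏ c` vs `v_p(c_p)`, `v_p(c_p) + 1`», «a second split prime». [cite: Miller2011LMS, Def. 1.1] -/
theorem excZeroCore_of_sectors (hS : ExcShallowSector) (hA : ExcGSSectorA) (hB : ExcGSSectorB) (hR : ExcResidualGS) :
    ∀ (W : WeierstrassCurve ℚ) [W.IsElliptic] [W.IsGloballyMinimal] (p : ℕ) [Fact p.Prime],
      ClassX11a W p → ¬ Surj W p → 5 ≤ p → W.HasSplitMultiplicativeReductionAtPrime p → MissingUpperBoundAt W p := by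
  intro W _ _ p _ hX hns hp5 hsp
  by_cases hSha : ∀ x : W.sha, (p : ℤ) • x = 0 → x = 0
  swap
  · push Not at hSha
    obtain ⟨x, hx, hx0⟩ := hSha
    exact hR W p hX hns hp5 hsp (Or.inl ⟨x, hx, hx0⟩)
  by_cases h1 : padicValNat p W.tamagawaProduct ≤ 1
  · exact hS W p hX hns hp5 hsp h1 hSha
  have h2 : 2 ≤ padicValNat p W.tamagawaProduct := by omega
  by_cases hw : LogTatePeriodUnit W p
  swap
  · exact hR W p hX hns hp5 hsp (Or.inr ⟨h2, Or.inl hw⟩)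
  by_cases hd : padicValNat p W.tamagawaProduct ≤ pDepthAtP W p
  · exact hA W p hX hns hp5 hsp hw hd hSha
  by_cases hd2 : pDepthAtP W p + 2 ≤ padicValNat p W.tamagawaProduct
  · exact hR W p hX hns hp5 hsp (Or.inr ⟨h2, Or.inr (Or.inl hd2)⟩)
  by_cases htwin : ∃ ℓ : ℕ, ∃ _ : Fact ℓ.Prime, ℓ ≠ p ∧ W.HasSplitMultiplicativeReductionAtPrime ℓ
  · exact hB W p hX hns hp5 hsp hw (by omega) htwin hSha
  · exact hR W p hX hns hp5 hsp (Or.inr ⟨h2, Or.inr (Or.inr ⟨by omega, htwin⟩)⟩)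

/-- **Comparison with the record (fact-free): the rev-11 open core C_exc♭ implies R_exc** — the line asks NO MORE of the future than rev 11.
[cite: Miller2011LMS, Def. 1.1] -/
theorem excResidualGS_of_excFlatCore (h : ExcFlatCore) : ExcResidualGS := by
  intro W _ _ p _ hX hns hp5 hsp hc
  refine h W p hX hns hp5 hsp ?_
  rcases hc with hc | ⟨h2, -⟩
  · exact Or.inl hc
  · exact Or.inr h2

/-- **C_exc — the record's rev-10 EXCEPTIONAL-ZERO core, VERBATIM** (`GL1Cartan.ExcZeroCoreResidual` of «gl1cartan5» rev 10: U5 at a SPLIT multiplicative `p`;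
the binder type of the turnkey `upperNonSurjFive_of_nineFacts_of_threeCores`). [cite: GreenbergStevens1993, Thm.] [cite: Kato2004Asterisque, §17.13] -/
def ExcZeroCore : Prop :=
  ∀ (W : WeierstrassCurve ℚ) [W.IsElliptic] [W.IsGloballyMinimal] (p : ℕ) [Fact p.Prime],
    ClassX11a W p → ¬ Surj W p → 5 ≤ p → W.HasSplitMultiplicativeReductionAtPrime p → MissingUpperBoundAt W p

/-- **Comparison with the record (fact-free): the rev-10 core C_exc implies C_exc♭.** [cite: Miller2011LMS, Def. 1.1] -/
theorem excFlatCore_of_excZeroCore (h : ExcZeroCore) : ExcFlatCore :=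
  fun W _ _ p _ hX hns hp5 hsp _ => h W p hX hns hp5 hsp

/-- **Conversely (modulo S_exc, A, B; fact-free here): C_exc♭ from R_exc** — so R_exc and C_exc♭ are EQUIVALENT modulo the fourteen facts and the KEY B.
[cite: Miller2011LMS, Def. 1.1] -/
theorem excFlatCore_of_sectors (hS : ExcShallowSector) (hA : ExcGSSectorA) (hB : ExcGSSectorB) (hR : ExcResidualGS) : ExcFlatCore :=
  fun W _ _ p _ hX hns hp5 hsp _ => excZeroCore_of_sectors hS hA hB hR W p hX hns hp5 hsp

/-- **No costume (fact-free): each sector ∕ residual of this line is U5 restricted.** [cite: Miller2011LMS, Def. 1.1] -/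
theorem parts_of_upperNonSurjFive (h : Theses.PrintX11a.UpperNonSurjFive) :
    ExcGSSectorA ∧ ExcGSSectorB ∧ ExcResidualGS ∧ ExcFlatCore :=
  ⟨fun W _ _ p _ hX hns hp5 _ _ _ _ => h W p hX hns hp5,
    fun W _ _ p _ hX hns hp5 _ _ _ _ _ => h W p hX hns hp5,
    fun W _ _ p _ hX hns hp5 _ _ => h W p hX hns hp5,
    fun W _ _ p _ hX hns hp5 _ _ => h W p hX hns hp5⟩

/-- **Composition from hypotheses**: nine facts + GS-odd + the four EXC-road facts + B + the record's two non-split cores + R_exc ⟹ U5 BY NAME, through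
the landed rev-10 turnkey `Theorems.GL1Cartan.upperNonSurjFive_of_nineFacts_of_threeCores` (UNIT and SHALLOW closed there; C_exc from
`excZeroCore_of_sectors` with S_exc = the landed `Exc.upperNonSurjFive_on_excShallowSector_of_facts`).
[cite: Miller2011LMS, Def. 1.1] [cite: Kato2004Asterisque, §17.13] [cite: Kobayashi2006DocMath, Cor. 4.2 (p. 575)] [cite: DarmonDiamondTaylor1995, Thm. 3.15] -/
theorem UpperNonSurjFive_of_hyps (hN : NineFacts) (hGS : GSOdd) (hE : ExcRoadFacts) (hB : TwinCarrierFirstMoment)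
    (hCx : ExponentCoreResidual) (hCt : DeepTamagawaCoreResidual) (hR : ExcResidualGS) :
    Theses.PrintX11a.UpperNonSurjFive := by
  obtain ⟨hJs, hJn, h12, hnf, hns', hsp', hfine', hMz, hGZK⟩ := hN
  obtain ⟨hCE, hGV, hI, hLL⟩ := hE
  exact upperNonSurjFive_of_nineFacts_of_threeCores hJs hJn h12 hnf hns' hsp' hfine' hMz hGZK
    (excZeroCore_of_sectors (Exc.upperNonSurjFive_on_excShallowSector_of_facts hCE hGV hI hMz hnf hLL hGZK)
      (excGSSectorA_of hGS hnf hMz hGZK) (excGSSectorB_of hGS hLL hB hnf hMz hGZK) hR) hCx hCt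

/-- **Composition U5 — the crux BY NAME, stub-fed (real proof; `sorry` only inside the five stubs).** [cite: Miller2011LMS, Def. 1.1] -/
theorem UpperNonSurjFive_of_gsdepth : Theses.PrintX11a.UpperNonSurjFive :=
  UpperNonSurjFive_of_hyps stub_printFacts.1 stub_printFacts.2.1 stub_printFacts.2.2 stub_twinCarrierFirstMoment
    stub_exponentCore stub_deepTamagawaCore stub_excResidualGS

end Summit.BirchSwinnertonDyer.BirchSwinnertonDyer.Cruxes.UpperNonSurjFive.GSDepth

end
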